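import Summits.Parity.GeneralizedHardyLittlewood.Theorems.LeeYangFibresRelativeDimOneTypeSplit
import Summits.Parity.GeneralizedHardyLittlewood.Theorems.LeeYangFibresRelativeDimOneCharacterNecessity
import Summits.Parity.GeneralizedHardyLittlewood.Theorems.LeeYangFibresRelativeDimOneGRHCalibrationChar
import Literature.NumberTheory.LFunctions.GRHCharacterPrimeSums
import Literature.NumberTheory.LFunctions.PrimeNumberTheoremProgressions
import HarnessLib

/-!
# Route `LeeYangFibres`, crux `RelativeDimOne` (stmt-Parity-14113), line `gallagher-backwards-split` (seat c2):
# GRH calibration of the `L`-atom — under GRH the crux IS the parity atom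

The reshaped line `gallagher-backwards-split` reduced the crux to the conjunction of two open atoms
(`relativeDimOne_iff_coreDecay_and_lowSecondMoment`, `relativeDimOne_iff_general` in
`Theorems/LeeYangFibresRelativeDimOneTypeSplit.lean`): the parity atom P′ = `IncidenceBandlimitedCoreDecay θ` and the
`L`-function atom L = `LowClassSecondMoment θ₁` (`Σ_{a mod q} ψ(N;q,a)² ≤ (1+ε)(N²/φ(q) + N log N)` for
`q ≤ N^{θ₁}`). The tree already has the LOWER calibration of L (it forces character PNT uniformly to conductor
`N^{θ₁}`, cf. `characterNecessity`). This file is the UPPER calibration: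

* `lowClassSecondMoment_of_grh` — **GRH ⇒ L at every level `θ₁ < 1`**: under the Generalised Riemann Hypothesis
  (`Literature.NumberTheory.LFunctions.GeneralizedRiemannHypothesis`) and the printed GRH-conditional prime number theorem
  for characters (Titchmarsh 1930; Montgomery–Vaughan Thm. 13.7 (13.21), the tree's named fact
  `Literature.NumberTheory.LFunctions.grh_primeCharSum_le`: `π(x, χ) ≪ x^{1/2} log(qx)` for `χ ≠ χ₀`),
  `LowClassSecondMoment θ₁` holds for every `θ₁ < 1`.
* `relativeDimOne_iff_coreDecay_of_grh` — hence, for every `0 < θ < 1`, **under GRH the crux `RelativeDimOne` is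
  EQUIVALENT to the parity atom `IncidenceBandlimitedCoreDecay θ` alone**.

So the `L`-atom is bracketed `UniformCharPNT(≤ N^{θ₁}) ⇐ LowClassSecondMoment θ₁ ⇐ GRH`, and all the
GRH-inaccessible content of the uniform Hardy–Littlewood conjecture (Green–Tao Conj. 1.4 error, `d = 1`) sits in P′.

## Proof of `lowClassSecondMoment_of_grh`

Parseval on `(ℤ/qℤ)ˣ` (`Literature.NumberTheory.Sieve.LargeSieve.sum_norm_sq_sum_char_mul`, as in `characterNecessity`):
`φ(q) Σ_{(a,q)=1} ψ(N;q,a)² = Σ_χ |ψ(N,χ)|² ≤ ψ(N)² + φ(q) max_{χ ≠ χ₀} |ψ(N,χ)|²`. For `χ ≠ χ₀`, Abel summation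
`log p = Σ_{m<p} log((m+1)/m)` turns the GRH bound `|π(x,χ)| ≤ C √x log(qx)` (`2 ≤ x ≤ N`) into
`|Σ_{p≤N} χ(p) log p| ≤ 2C √N log(qN) log N`, and the prime powers contribute `≤ ψ(N) − ϑ(N) ≤ 2√N log N`
(tools file `…GRHCalibrationChar.lean`); so `|ψ(N,χ)|² ≤ K² N log⁴ N`, and `φ(q) · K² N log⁴N ≤ (ε/4)N²` needs only
`φ(q) ≤ N^{θ₁}` and `log⁴ N = o(N^{1-θ₁})`; dividing Parseval by `φ(q)` gives the coprime classes
`≤ ψ(N)²/φ(q) + K² N log⁴ N ≤ (1+ε/2)N²/φ(q) + (ε/4)N²/φ(q)` by the prime number theorem `ψ(N) ~ N`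
(`Literature.NumberTheory.LFunctions.chebyshevPsi_sub_self_isLittleO`). The non-coprime classes carry only powers of
the primes dividing `q`: their total is `ψ(N) − Σ_{(n,q)=1} Λ(n) ≤ ψ(N) − ϑ(N) + log q ≤ 3√N log N`
(`CharacterNecessity.theta_sub_log_le`), so their squares sum to `≤ 9 N log² N ≤ (ε/4) N²/φ(q)` (again `q ≤ N^{θ₁}`).
Total `≤ (1+ε) N²/φ(q)`.

References: Montgomery–Vaughan, *Multiplicative Number Theory I* (2007), Thm. 13.7 [MontgomeryVaughan2007]; Davenport,
*Multiplicative Number Theory*, ch. 20 [DavenportMNT1980]; Gallagher, Mathematika 23 (1976) [Gallagher1976].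
-/

noncomputable section

open scoped BigOperators ArithmeticFunction.vonMangoldt
open Finset Filter Asymptotics
open Literature.NumberTheory.LFunctions
open Summit.Parity.GeneralizedHardyLittlewood.Theses.LeeYangFibres (RelativeDimOne)
open Summit.Parity.GeneralizedHardyLittlewood.Cruxes.RelativeDimOne.GallagherBackwards
open Summit.Parity.GeneralizedHardyLittlewood.Cruxes.RelativeDimOne.GallagherBackwardsSplit

namespace Summit.Parity.GeneralizedHardyLittlewood.Cruxes.RelativeDimOne.TypeSplit

namespace GRHCalibration

open GallagherBackwards.GRHCalibration

variable {q : ℕ}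

/-! ### Parseval and the non-coprime classes -/

section Parseval

variable [NeZero q]

/-- Parseval on `(ℤ/qℤ)ˣ`: `φ(q) Σ_{(a,q)=1} ψ(N;q,a)² = Σ_χ |ψ(N,χ)|²`. -/
theorem totient_mul_sum_coprime_sq (N : ℕ) :
    (q.totient : ℝ) * ∑ a ∈ (range q).filter (fun a => a.Coprime q), classPsi N q a ^ 2 =
      ∑ χ : DirichletCharacter ℂ q, ‖charPsi χ N‖ ^ 2 := by
  have h := Literature.NumberTheory.Sieve.LargeSieve.sum_norm_sq_sum_char_mul (q := q)
    (fun b => (classPsi N q b : ℂ))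
  have h2 : ∑ χ : DirichletCharacter ℂ q, ‖charPsi χ N‖ ^ 2 =
      ∑ χ : DirichletCharacter ℂ q, ‖∑ b ∈ range q, χ b * (classPsi N q b : ℂ)‖ ^ 2 :=
    Fintype.sum_congr _ _ fun χ => by rw [CharacterNecessity.charPsi_eq_sum_range]
  rw [h2, h]
  congr 1
  refine sum_congr rfl fun b _ => ?_
  rw [Complex.norm_real, Real.norm_eq_abs, sq_abs]

/-- `Σ_χ |ψ(N,χ)|² ≤ ψ(N)² + φ(q) M²` if `|ψ(N,χ)| ≤ M` for all `χ ≠ χ₀`. -/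
theorem sum_norm_sq_charPsi_le_of_bound (N : ℕ) {M : ℝ}
    (hχ : ∀ χ : DirichletCharacter ℂ q, χ ≠ 1 → ‖charPsi χ N‖ ≤ M) :
    ∑ χ : DirichletCharacter ℂ q, ‖charPsi χ N‖ ^ 2 ≤ Chebyshev.psi N ^ 2 + (q.totient : ℝ) * M ^ 2 := by
  classical
  rw [← Finset.add_sum_erase _ _ (mem_univ (1 : DirichletCharacter ℂ q))]
  refine add_le_add ?_ ?_
  · -- principal character: `|ψ(N, χ₀)| ≤ ψ(N)`
    have h1 : ‖charPsi (1 : DirichletCharacter ℂ q) N‖ ≤ Chebyshev.psi N := by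
      rw [CharacterNecessity.charPsi_one, Complex.norm_real, Real.norm_of_nonneg
        (sum_nonneg fun _ _ => ArithmeticFunction.vonMangoldt_nonneg), psi_eq_sum_Icc]
      exact sum_le_sum_of_subset_of_nonneg (filter_subset _ _)
        fun _ _ _ => ArithmeticFunction.vonMangoldt_nonneg
    exact pow_le_pow_left₀ (norm_nonneg _) h1 2
  · calc ∑ χ ∈ (univ : Finset (DirichletCharacter ℂ q)).erase 1, ‖charPsi χ N‖ ^ 2
        ≤ ∑ χ ∈ (univ : Finset (DirichletCharacter ℂ q)).erase 1, M ^ 2 :=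
          sum_le_sum fun χ hχ' => pow_le_pow_left₀ (norm_nonneg _) (hχ χ (ne_of_mem_erase hχ')) 2
      _ = (((univ : Finset (DirichletCharacter ℂ q)).erase 1).card : ℝ) * M ^ 2 := by
          rw [sum_const, nsmul_eq_mul]
      _ ≤ (q.totient : ℝ) * M ^ 2 := by
          refine mul_le_mul_of_nonneg_right ?_ (sq_nonneg _)
          have hcard : ((univ : Finset (DirichletCharacter ℂ q)).erase 1).card ≤ q.totient := by
            calc ((univ : Finset (DirichletCharacter ℂ q)).erase 1).card
                ≤ (univ : Finset (DirichletCharacter ℂ q)).card := card_erase_le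
              _ = Fintype.card (DirichletCharacter ℂ q) := card_univ
              _ = Nat.card (DirichletCharacter ℂ q) := Nat.card_eq_fintype_card.symm
              _ = q.totient := DirichletCharacter.card_eq_totient_of_hasEnoughRootsOfUnity ℂ q
          exact_mod_cast hcard

/-- The non-coprime classes: `Σ_{(a,q)>1} ψ(N;q,a) = Σ_{n ≤ N, (n,q)>1} Λ(n)`. -/
theorem sum_not_coprime_classPsi (N : ℕ) :
    ∑ a ∈ (range q).filter (fun a => ¬ a.Coprime q), classPsi N q a =
      ∑ n ∈ (Icc 1 N).filter (fun n => ¬ n.Coprime q), Λ n := by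
  have hq : 0 < q := Nat.pos_of_ne_zero (NeZero.ne q)
  unfold classPsi
  calc ∑ a ∈ (range q).filter (fun a => ¬ a.Coprime q), ∑ n ∈ (Icc 1 N).filter (fun n => n % q = a), Λ n
      = ∑ a ∈ (range q).filter (fun a => ¬ a.Coprime q), ∑ n ∈ Icc 1 N, (if n % q = a then Λ n else 0) := by
        refine sum_congr rfl fun a _ => ?_
        rw [sum_filter]
    _ = ∑ n ∈ Icc 1 N, ∑ a ∈ (range q).filter (fun a => ¬ a.Coprime q), (if n % q = a then Λ n else 0) :=
        sum_comm
    _ = ∑ n ∈ Icc 1 N, (if ¬ n.Coprime q then Λ n else 0) := by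
        refine sum_congr rfl fun n _ => ?_
        rw [sum_ite_eq]
        have hiff : n % q ∈ (range q).filter (fun a => ¬ a.Coprime q) ↔ ¬ n.Coprime q := by
          simp only [mem_filter, mem_range, Nat.mod_lt n hq, true_and]
          rw [Nat.Coprime, Nat.Coprime, ← Nat.gcd_rec, Nat.gcd_comm]
        by_cases h : n.Coprime q
        · rw [if_neg (mt hiff.1 (not_not.2 h)), if_neg (not_not.2 h)]
        · rw [if_pos (hiff.2 h), if_pos h]
    _ = ∑ n ∈ (Icc 1 N).filter (fun n => ¬ n.Coprime q), Λ n := by rw [sum_filter]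

/-- `Σ_{n ≤ N, (n,q)>1} Λ(n) ≤ ψ(N) − ϑ(N) + log q ≤ 3 √N log N` for `1 ≤ q ≤ N`. -/
theorem sum_not_coprime_vonMangoldt_le {N : ℕ} (hN : 1 ≤ N) (hqN : q ≤ N) :
    ∑ n ∈ (Icc 1 N).filter (fun n => ¬ n.Coprime q), Λ n ≤ 3 * Real.sqrt N * Real.log N := by
  have hq : 0 < q := Nat.pos_of_ne_zero (NeZero.ne q)
  have hsplit := sum_filter_add_sum_filter_not (Icc 1 N) (fun n => n.Coprime q) (fun n => (Λ n : ℝ))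
  have hcop := CharacterNecessity.theta_sub_log_le hq N
  have hpsi := psi_eq_sum_Icc N
  have hpt := Chebyshev.psi_sub_theta_le (x := (N : ℝ)) (by exact_mod_cast hN)
  have hNr : (1 : ℝ) ≤ N := by exact_mod_cast hN
  have hlogq : Real.log q ≤ Real.log N := Real.log_le_log (by exact_mod_cast hq) (by exact_mod_cast hqN)
  have hlogN : 0 ≤ Real.log N := Real.log_nonneg hNr
  have hsq : 1 ≤ Real.sqrt N := by
    rw [show (1 : ℝ) = Real.sqrt 1 from Real.sqrt_one.symm]
    exact Real.sqrt_le_sqrt hNr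
  have : ∑ n ∈ (Icc 1 N).filter (fun n => ¬ n.Coprime q), Λ n ≤
      (Chebyshev.psi N - Chebyshev.theta N) + Real.log q := by linarith
  calc ∑ n ∈ (Icc 1 N).filter (fun n => ¬ n.Coprime q), Λ n
      ≤ 2 * Real.sqrt N * Real.log N + Real.log N := by linarith
    _ ≤ 3 * Real.sqrt N * Real.log N := by nlinarith

/-- Squares of the non-coprime classes: `Σ_{(a,q)>1} ψ(N;q,a)² ≤ 9 N (log N)²` for `1 ≤ q ≤ N`. -/
theorem sum_not_coprime_sq_le {N : ℕ} (hN : 1 ≤ N) (hqN : q ≤ N) :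
    ∑ a ∈ (range q).filter (fun a => ¬ a.Coprime q), classPsi N q a ^ 2 ≤ 9 * N * Real.log N ^ 2 := by
  set T := (range q).filter (fun a => ¬ a.Coprime q) with hT
  set S := ∑ a ∈ T, classPsi N q a with hS
  have hS3 : S ≤ 3 * Real.sqrt N * Real.log N := by
    rw [hS, hT, sum_not_coprime_classPsi]
    exact sum_not_coprime_vonMangoldt_le hN hqN
  have hS0 : 0 ≤ S := sum_nonneg fun a _ => classPsi_nonneg N q a
  have hle : ∀ a ∈ T, classPsi N q a ≤ S := fun a ha =>
    single_le_sum (f := fun a => classPsi N q a) (fun b _ => classPsi_nonneg N q b) ha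
  calc ∑ a ∈ T, classPsi N q a ^ 2 ≤ ∑ a ∈ T, classPsi N q a * S := by
        refine sum_le_sum fun a ha => ?_
        rw [sq]
        exact mul_le_mul_of_nonneg_left (hle a ha) (classPsi_nonneg N q a)
    _ = S * S := by rw [← sum_mul]
    _ ≤ (3 * Real.sqrt N * Real.log N) * (3 * Real.sqrt N * Real.log N) :=
        mul_le_mul hS3 hS3 hS0 (hS0.trans hS3)
    _ = 9 * (Real.sqrt N) ^ 2 * Real.log N ^ 2 := by ring
    _ = 9 * N * Real.log N ^ 2 := by rw [Real.sq_sqrt (Nat.cast_nonneg N)]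

end Parseval

/-! ### Growth lemmas -/

/-- PNT: `ψ(N) ≤ (1 + δ) N` eventually. -/
theorem eventually_psi_le {δ : ℝ} (hδ : 0 < δ) :
    ∀ᶠ N : ℕ in atTop, Chebyshev.psi N ≤ (1 + δ) * N := by
  filter_upwards [chebyshevPsi_sub_self_isLittleO.def hδ] with N hN
  rw [Real.norm_eq_abs, Real.norm_of_nonneg (Nat.cast_nonneg N)] at hN
  linarith [le_abs_self (Chebyshev.psi N - N)]

/-- `A N^{θ₁} (log N)^r ≤ c N` eventually, for `θ₁ < 1`. -/
theorem eventually_rpow_mul_log_pow_le {θ₁ : ℝ} (hθ₁ : θ₁ < 1) (r : ℕ) {A c : ℝ} (hA : 0 ≤ A) (hc : 0 < c) :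
    ∀ᶠ N : ℕ in atTop, A * (N : ℝ) ^ θ₁ * Real.log N ^ r ≤ c * N := by
  have hs : 0 < 1 - θ₁ := by linarith
  have hc' : 0 < c / (A + 1) := div_pos hc (by linarith)
  have h := ((isLittleO_log_rpow_rpow_atTop (r : ℝ) hs).comp_tendsto tendsto_natCast_atTop_atTop).def hc'
  filter_upwards [h, eventually_ge_atTop 1] with N hN hN1
  have hNr : (0 : ℝ) < N := by exact_mod_cast hN1
  simp only [Function.comp, Real.rpow_natCast] at hN
  rw [Real.norm_of_nonneg (pow_nonneg (Real.log_nonneg (by exact_mod_cast hN1)) r),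
    Real.norm_of_nonneg (Real.rpow_nonneg hNr.le _)] at hN
  have hsplit : (N : ℝ) = (N : ℝ) ^ θ₁ * (N : ℝ) ^ (1 - θ₁) := by
    rw [← Real.rpow_add hNr]
    norm_num
  have hθpos : 0 ≤ (N : ℝ) ^ θ₁ := Real.rpow_nonneg hNr.le _
  calc A * (N : ℝ) ^ θ₁ * Real.log N ^ r ≤ A * (N : ℝ) ^ θ₁ * (c / (A + 1) * (N : ℝ) ^ (1 - θ₁)) :=
        mul_le_mul_of_nonneg_left hN (mul_nonneg hA hθpos)
    _ = (A / (A + 1)) * c * ((N : ℝ) ^ θ₁ * (N : ℝ) ^ (1 - θ₁)) := by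
        field_simp
    _ ≤ 1 * c * ((N : ℝ) ^ θ₁ * (N : ℝ) ^ (1 - θ₁)) := by
        have : A / (A + 1) ≤ 1 := by
          rw [div_le_one (by linarith)]
          linarith
        gcongr
    _ = c * N := by rw [← hsplit, one_mul]

/-! ### The class second moment from a GRH-shaped character bound -/

/-- **The sharp class second moment below any level `N^{θ₁}`, `θ₁ < 1`, from square-root cancellation in
`ψ(N, χ)`**: if `|ψ(N,χ)| ≤ K √N (log N)²` for all non-principal `χ mod q`, `1 ≤ q ≤ N`, `N ≥ 2`, then
`LowClassSecondMoment θ₁`. -/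
theorem lowClassSecondMoment_of_charBound {K : ℝ} (hK : 0 ≤ K)
    (hχ : ∀ (q : ℕ) [NeZero q] (χ : DirichletCharacter ℂ q), χ ≠ 1 → ∀ N : ℕ, 2 ≤ N → q ≤ N →
      ‖charPsi χ N‖ ≤ K * Real.sqrt N * Real.log N ^ 2)
    {θ₁ : ℝ} (hθ₁ : θ₁ < 1) : LowClassSecondMoment θ₁ := by
  intro ε hε
  set ε' := min ε 1 with hε'
  have hε'0 : 0 < ε' := lt_min hε one_pos
  have hε'1 : ε' ≤ 1 := min_le_right _ _
  have hε'ε : ε' ≤ ε := min_le_left _ _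
  have hδ : (0 : ℝ) < ε' / 5 := by positivity
  obtain ⟨N₀, hN₀⟩ := Filter.eventually_atTop.1 ((eventually_psi_le hδ).and
    (((eventually_rpow_mul_log_pow_le hθ₁ 4 (sq_nonneg K) (show 0 < ε' / 4 by positivity)).and
      (eventually_rpow_mul_log_pow_le hθ₁ 2 (show (0 : ℝ) ≤ 9 by norm_num) (show 0 < ε' / 4 by positivity))).and
        (eventually_ge_atTop 2)))
  refine ⟨N₀, fun N hN q hq hqθ => ?_⟩
  obtain ⟨hpsi, ⟨hE2, hE3⟩, hN2⟩ := hN₀ N hN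
  haveI : NeZero q := ⟨by omega⟩
  have hN1 : 1 ≤ N := by omega
  have hNr : (1 : ℝ) ≤ N := by exact_mod_cast hN1
  have hNpos : (0 : ℝ) < N := by positivity
  -- `q ≤ N^{θ₁} ≤ N`
  have hqN : q ≤ N := by
    have : (q : ℝ) ≤ N := hqθ.trans (by
      calc (N : ℝ) ^ θ₁ ≤ (N : ℝ) ^ (1 : ℝ) := Real.rpow_le_rpow_of_exponent_le hNr hθ₁.le
        _ = N := Real.rpow_one _)
    exact_mod_cast this
  have hφpos : (0 : ℝ) < q.totient := by exact_mod_cast Nat.totient_pos.2 (by omega)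
  have hφq : (q.totient : ℝ) ≤ q := by exact_mod_cast Nat.totient_le q
  have hφθ : (q.totient : ℝ) ≤ (N : ℝ) ^ θ₁ := hφq.trans hqθ
  -- the character bound at this `N`
  set M := K * Real.sqrt N * Real.log N ^ 2 with hMdef
  have hM0 : 0 ≤ M := by positivity
  have hMχ : ∀ χ : DirichletCharacter ℂ q, χ ≠ 1 → ‖charPsi χ N‖ ≤ M := fun χ h => hχ q χ h N hN2 hqN
  -- coprime classes (Parseval)
  have hcop : (q.totient : ℝ) * ∑ a ∈ (range q).filter (fun a => a.Coprime q), classPsi N q a ^ 2 ≤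
      Chebyshev.psi N ^ 2 + (q.totient : ℝ) * M ^ 2 := by
    rw [totient_mul_sum_coprime_sq]
    exact sum_norm_sq_charPsi_le_of_bound N hMχ
  -- non-coprime classes
  have hnc : ∑ a ∈ (range q).filter (fun a => ¬ a.Coprime q), classPsi N q a ^ 2 ≤ 9 * N * Real.log N ^ 2 :=
    sum_not_coprime_sq_le hN1 hqN
  -- assemble `φ(q) · Σ_a ψ(N;q,a)² ≤ (1 + ε') N²`
  have hsplit := sum_filter_add_sum_filter_not (range q) (fun a => a.Coprime q) (fun a => classPsi N q a ^ 2)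
  have hψ0 : 0 ≤ Chebyshev.psi N := Chebyshev.psi_nonneg _
  have hψ2 : Chebyshev.psi N ^ 2 ≤ (1 + ε' / 2) * (N : ℝ) ^ 2 := by
    have h1 : Chebyshev.psi N ^ 2 ≤ ((1 + ε' / 5) * N) ^ 2 := pow_le_pow_left₀ hψ0 hpsi 2
    have h2 : (1 + ε' / 5) ^ 2 ≤ 1 + ε' / 2 := by nlinarith
    calc Chebyshev.psi N ^ 2 ≤ ((1 + ε' / 5) * N) ^ 2 := h1
      _ = (1 + ε' / 5) ^ 2 * (N : ℝ) ^ 2 := by ring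
      _ ≤ (1 + ε' / 2) * (N : ℝ) ^ 2 := mul_le_mul_of_nonneg_right h2 (sq_nonneg _)
  have hM2 : (q.totient : ℝ) * M ^ 2 ≤ ε' / 4 * (N : ℝ) ^ 2 := by
    have hθpos : 0 ≤ (N : ℝ) ^ θ₁ := Real.rpow_nonneg hNpos.le _
    calc (q.totient : ℝ) * M ^ 2 = (q.totient : ℝ) * (K ^ 2 * Real.log N ^ 4) * Real.sqrt N ^ 2 := by
          rw [hMdef]; ring
      _ = (q.totient : ℝ) * (K ^ 2 * Real.log N ^ 4) * N := by rw [Real.sq_sqrt hNpos.le]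
      _ ≤ (N : ℝ) ^ θ₁ * (K ^ 2 * Real.log N ^ 4) * N := by gcongr
      _ = (K ^ 2 * (N : ℝ) ^ θ₁ * Real.log N ^ 4) * N := by ring
      _ ≤ (ε' / 4 * N) * N := mul_le_mul_of_nonneg_right hE2 hNpos.le
      _ = ε' / 4 * (N : ℝ) ^ 2 := by ring
  have hnc2 : (q.totient : ℝ) * (9 * N * Real.log N ^ 2) ≤ ε' / 4 * (N : ℝ) ^ 2 := by
    calc (q.totient : ℝ) * (9 * N * Real.log N ^ 2) ≤ (N : ℝ) ^ θ₁ * (9 * N * Real.log N ^ 2) := by gcongr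
      _ = (9 * (N : ℝ) ^ θ₁ * Real.log N ^ 2) * N := by ring
      _ ≤ (ε' / 4 * N) * N := mul_le_mul_of_nonneg_right hE3 hNpos.le
      _ = ε' / 4 * (N : ℝ) ^ 2 := by ring
  have htot : (q.totient : ℝ) * ∑ a ∈ range q, classPsi N q a ^ 2 ≤ (1 + ε') * (N : ℝ) ^ 2 := by
    rw [← hsplit, mul_add]
    have hnc' : (q.totient : ℝ) * ∑ a ∈ (range q).filter (fun a => ¬ a.Coprime q), classPsi N q a ^ 2 ≤
        ε' / 4 * (N : ℝ) ^ 2 := (mul_le_mul_of_nonneg_left hnc hφpos.le).trans hnc2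
    linarith
  -- divide by `φ(q)` and add the (unused) `N log N` slack
  have hNlog : 0 ≤ (N : ℝ) * Real.log N := mul_nonneg hNpos.le (Real.log_nonneg hNr)
  have hdiv : ∑ a ∈ range q, classPsi N q a ^ 2 ≤ (1 + ε') * ((N : ℝ) ^ 2 / q.totient) := by
    rw [mul_div_assoc', le_div_iff₀ hφpos, mul_comm]
    exact htot
  calc ∑ a ∈ range q, classPsi N q a ^ 2 ≤ (1 + ε') * ((N : ℝ) ^ 2 / q.totient) := hdiv
    _ ≤ (1 + ε) * ((N : ℝ) ^ 2 / q.totient) := by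
        gcongr
    _ ≤ (1 + ε) * ((N : ℝ) ^ 2 / q.totient + N * Real.log N) := by
        have : 0 ≤ 1 + ε := by linarith
        gcongr
        linarith
end GRHCalibration

/-! ### GRH ⇒ the `L`-atom at every level; under GRH the crux is the parity atom -/

open GRHCalibration GallagherBackwards.GRHCalibration in
/-- **GRH calibration of atom L** (registered hook `lowClassSecondMoment_of_grh` of stmt-Parity-14113): under the
Generalised Riemann Hypothesis and the printed GRH-conditional prime number theorem for characters (Titchmarsh 1930,
Montgomery–Vaughan Thm. 13.7 (13.21); the tree's named fact `Literature.NumberTheory.LFunctions.grh_primeCharSum_le`),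
the sharp class second moment `Σ_{a mod q} ψ(N;q,a)² ≤ (1+ε)(N²/φ(q) + N log N)` holds for all `q ≤ N^{θ₁}`, for EVERY
`θ₁ < 1`. Conditional by design (GRH) and on the named fact. -/
theorem lowClassSecondMoment_of_grh :
    Literature.NumberTheory.LFunctions.grh_primeCharSum_le →
      Literature.NumberTheory.LFunctions.GeneralizedRiemannHypothesis →
        ∀ θ₁ : ℝ, θ₁ < 1 → LowClassSecondMoment θ₁ := by
  intro hT hGRH θ₁ hθ₁
  obtain ⟨C, hC⟩ := hT
  have hC'0 : 0 ≤ max C 0 := le_max_right _ _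
  refine lowClassSecondMoment_of_charBound (K := 4 * max C 0 + 3) (by positivity) ?_ hθ₁
  intro q _ χ hχ N hN hqN
  have hq : 1 ≤ q := Nat.pos_of_ne_zero (NeZero.ne q)
  refine norm_charPsi_le_of_primePi hC'0 χ hq hqN hN fun m hm => ?_
  have hRH : ∀ χ' : DirichletCharacter ℂ q, χ'.RiemannHypothesis := fun χ' => hGRH.dirichletCharacter χ'
  have h := hC q hRH χ hχ (m : ℝ) (by exact_mod_cast hm)
  rw [Nat.floor_natCast, ← Real.sqrt_eq_rpow] at h
  refine h.trans ?_
  have hqr : (1 : ℝ) ≤ q := by exact_mod_cast hq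
  have hmr : (2 : ℝ) ≤ m := by exact_mod_cast hm
  have hlog : 0 ≤ Real.log ((q : ℝ) * m) := Real.log_nonneg (by nlinarith)
  have hsq : 0 ≤ Real.sqrt m := Real.sqrt_nonneg _
  gcongr
  exact le_max_left _ _

/-- Under GRH (and the MV 13.7 fact) the statement of the registered atom `stub_lowSecondMoment` holds. -/
theorem lowClassSecondMoment_one_third_of_grh
    (hT : Literature.NumberTheory.LFunctions.grh_primeCharSum_le)
    (hGRH : Literature.NumberTheory.LFunctions.GeneralizedRiemannHypothesis) :
    LowClassSecondMoment (1 / 3) :=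
  lowClassSecondMoment_of_grh hT hGRH (1 / 3) (by norm_num)

/-- **Under GRH the crux is the parity atom**: for every `0 < θ < 1`,
`RelativeDimOne ↔ IncidenceBandlimitedCoreDecay θ` (the `L`-atom of `relativeDimOne_iff_general` is discharged by
`lowClassSecondMoment_of_grh`; the forward direction `coreDecay_of_relativeDimOne` is unconditional). -/
theorem relativeDimOne_iff_coreDecay_of_grh
    (hT : Literature.NumberTheory.LFunctions.grh_primeCharSum_le)
    (hGRH : Literature.NumberTheory.LFunctions.GeneralizedRiemannHypothesis)
    {θ : ℝ} (hθ0 : 0 < θ) (hθ1 : θ < 1) :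
    RelativeDimOne ↔ IncidenceBandlimitedCoreDecay θ :=
  ⟨fun h => coreDecay_of_relativeDimOne hθ0 h,
    fun hP => relativeDimOne_of_atoms_general hθ0 hθ1 (by norm_num : (0 : ℝ) < 1 / 2) hP
      (lowClassSecondMoment_of_grh hT hGRH (1 / 2) (by norm_num))⟩

end Summit.Parity.GeneralizedHardyLittlewood.Cruxes.RelativeDimOne.TypeSplit

end
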